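import Literature.NumberTheory.PAdicHodge.BdRPlusEmbedding
import Mathlib.RingTheory.Localization.FractionRing
import Mathlib.Algebra.Ring.Action.End
import HarnessLib

/-!
# The field `B_dR(F) = Frac B_dR⁺(F)`: Galois action, `F`-algebra structure, filtration

Let `F` be a nonarchimedean local field of characteristic `0`, residue characteristic `p`,
`v(p) < 1`. With `B_dR⁺(F)` a complete DVR (file `BdRPlusDVR`) we set
`B_dR(F) := Frac B_dR⁺(F)` (`FracBdR`, Mathlib `FractionRing`; this is also `B_dR⁺[1/ξ]`) and
construct (Fontaine 1994, Exp. II §1.5.5–1.5.6; Fontaine–Ouyang §5.2):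

* the `Γ_F`-action on `B_dR` by field automorphisms extending `galBdRPlus`
  (`galBdRPlusAut`, `instMulSemiringActionFracBdR`, `smul_algebraMap_fracBdR`);
* the `F`-algebra structure through `F ↪ B_dR⁺` (`fracAlgebra hp hF`, to be installed with `letI`)
  commuting with the action (`smulCommClass_fracBdR`);
* the filtration **`Fil^i B_dR = ξ^i B_dR⁺`** (`fil hp hF i`, an `F`-submodule, `i : ℤ`):
  decreasing, multiplicative, `1 ∈ Fil⁰`, `Γ_F`-stable, exhaustive and separated
  (`fil_antitone`, `mul_mem_fil`, `one_mem_fil_zero`, `smul_mem_fil`, `iSup_fil`, `iInf_fil`);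
* structure of nonzero elements: **`x = u^m · w`**, `m ∈ ℤ`, `w ∈ (B_dR⁺)ˣ`, for the uniformizer
  `u = [ε] − 1` (`exists_eq_uBdR_zpow_mul`).

## References
* [FontaineAsterisque223III] J.-M. Fontaine, *Le corps des périodes p-adiques*, Astérisque 223
  (1994), Exp. II, §1.5.5–1.5.6.
* [FontaineOuyang2022] J.-M. Fontaine, Y. Ouyang, *Theory of p-adic Galois representations*
  (book draft), §5.2.
-/

noncomputable section

open ValuativeRel Field Ideal WittVector UniformSpace
open Literature.AlgebraicGeometry.Resolution

namespace Literature.NumberTheory.PAdicHodge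

open Literature.NumberTheory.GaloisRepresentations
open Literature.NumberTheory.GaloisRepresentations.IsNonarchimedeanLocalField

variable {F : Type} [Field F] [ValuativeRel F] [TopologicalSpace F] [IsNonarchimedeanLocalField F]
  [CharZero F] {p : ℕ} [Fact p.Prime] [Fact (¬ IsUnit (p : integerC F))]
  [IsAdicComplete (Ideal.span {(p : integerC F)}) (integerC F)]

/-! ### `Γ_F → Aut(B_dR⁺)` -/

/-- `σ` as a ring automorphism of `B_dR⁺(F)` (inverse `σ⁻¹`). [folklore] -/
def galBdRPlusEquiv (σ : absoluteGaloisGroup F) : BDeRhamPlus (integerC F) p ≃+* BDeRhamPlus (integerC F) p :=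
  RingEquiv.ofRingHom (galBdRPlus σ) (galBdRPlus σ⁻¹)
    (RingHom.ext fun x => by rw [RingHom.comp_apply, ← galBdRPlus_mul, mul_inv_cancel, galBdRPlus_one]; rfl)
    (RingHom.ext fun x => by rw [RingHom.comp_apply, ← galBdRPlus_mul, inv_mul_cancel, galBdRPlus_one]; rfl)

/-- Unfolding of `galBdRPlusEquiv`. [folklore] -/
@[simp] theorem galBdRPlusEquiv_apply (σ : absoluteGaloisGroup F) (x : BDeRhamPlus (integerC F) p) :
    galBdRPlusEquiv σ x = galBdRPlus σ x := rfl

/-- **`Γ_F → Aut(B_dR⁺(F))`** as a group homomorphism. [cite: FontaineAsterisque223III, Exp. II §1.5.5] -/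
def galBdRPlusAut : absoluteGaloisGroup F →* RingAut (BDeRhamPlus (integerC F) p) where
  toFun := galBdRPlusEquiv
  map_one' := RingEquiv.ext fun x => galBdRPlus_one x
  map_mul' σ τ := RingEquiv.ext fun x => galBdRPlus_mul σ τ x

/-- Unfolding of `galBdRPlusAut`. [folklore] -/
@[simp] theorem galBdRPlusAut_apply (σ : absoluteGaloisGroup F) (x : BDeRhamPlus (integerC F) p) :
    galBdRPlusAut σ x = galBdRPlus σ x := rfl

/-! ### `B_dR(F) = Frac B_dR⁺(F)` and its Galois action -/

variable (F p) in
/-- **`B_dR(F) := Frac B_dR⁺(F)`** (Mathlib `FractionRing`; a field once `B_dR⁺` is known to be a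
domain, `BdRPlusDVR`). [cite: FontaineAsterisque223III, Exp. II §1.5.5] -/
abbrev FracBdR : Type := FractionRing (BDeRhamPlus (integerC F) p)

omit [CharZero F] in
/-- `B_dR⁺ → B_dR` is injective. [folklore] -/
theorem algebraMap_fracBdR_injective :
    Function.Injective (algebraMap (BDeRhamPlus (integerC F) p) (FracBdR F p)) :=
  IsFractionRing.injective _ _

/-- **`σ(ξ) = ξ · d_σ` with `d_σ` a unit of `B_dR⁺`.** [cite: FontaineAsterisque223III, Exp. II §1.5.5] -/
theorem exists_unit_galBdRPlus_xiBdR (σ : absoluteGaloisGroup F) :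
    ∃ d : (BDeRhamPlus (integerC F) p)ˣ, galBdRPlus σ (xiBdR : BDeRhamPlus (integerC F) p) = xiBdR * (d : BDeRhamPlus (integerC F) p) := by
  obtain ⟨d, hd⟩ := Ideal.mem_span_singleton'.1 (galBdRPlus_mem_span σ (Ideal.mem_span_singleton_self (xiBdR : BDeRhamPlus (integerC F) p)))
  obtain ⟨d', hd'⟩ := Ideal.mem_span_singleton'.1 (galBdRPlus_mem_span σ⁻¹ (Ideal.mem_span_singleton_self (xiBdR : BDeRhamPlus (integerC F) p)))
  -- `σ(d') d = 1`
  have h1 : xiBdR * (galBdRPlus σ d' * d - 1) = 0 := by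
    have h2 : galBdRPlus σ (galBdRPlus σ⁻¹ xiBdR) = (xiBdR : BDeRhamPlus (integerC F) p) := by
      rw [← galBdRPlus_mul, mul_inv_cancel, galBdRPlus_one]
    rw [← hd', map_mul, ← hd] at h2
    linear_combination h2
  have h3 : galBdRPlus σ d' * d = 1 := sub_eq_zero.1 (eq_zero_of_xiBdR_mul_eq_zero h1)
  refine ⟨(IsUnit.of_mul_eq_one_right _ h3).unit, ?_⟩
  rw [IsUnit.unit_spec, ← hd, mul_comm]

/-- **The `Γ_F`-action on `B_dR(F)`** by field automorphisms (extension of automorphisms to the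
fraction field, Mathlib `IsFractionRing.ringEquivOfRingEquivHom`). [cite: FontaineAsterisque223III, Exp. II §1.5.5] -/
instance instMulSemiringActionFracBdR : MulSemiringAction (absoluteGaloisGroup F) (FracBdR F p) :=
  MulSemiringAction.compHom (FracBdR F p)
    ((IsFractionRing.ringEquivOfRingEquivHom (BDeRhamPlus (integerC F) p) (FracBdR F p)).comp galBdRPlusAut)

/-- Unfolding of the action on `B_dR(F)`. [folklore] -/
theorem smul_fracBdR_def (σ : absoluteGaloisGroup F) (x : FracBdR F p) :
    σ • x = IsFractionRing.ringEquivOfRingEquiv (K := FracBdR F p) (L := FracBdR F p) (galBdRPlusEquiv (p := p) σ) x := rfl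

/-- **The action on `B_dR` extends the action on `B_dR⁺`.** [cite: FontaineAsterisque223III, Exp. II §1.5.5] -/
@[simp] theorem smul_algebraMap_fracBdR (σ : absoluteGaloisGroup F) (b : BDeRhamPlus (integerC F) p) :
    σ • algebraMap (BDeRhamPlus (integerC F) p) (FracBdR F p) b =
      algebraMap (BDeRhamPlus (integerC F) p) (FracBdR F p) (galBdRPlus σ b) := by
  rw [smul_fracBdR_def, IsFractionRing.ringEquivOfRingEquiv_algebraMap]; rfl

/-- `σ` acts on `B_dR` by a ring homomorphism (for `map_*` lemmas). [folklore] -/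
theorem smul_fracBdR_eq_toRingHom (σ : absoluteGaloisGroup F) (x : FracBdR F p) :
    σ • x = MulSemiringAction.toRingHom (absoluteGaloisGroup F) (FracBdR F p) σ x := rfl

/-! ### The `F`-algebra structure -/

section Algebra

variable (hp : valuation F p < 1) (hF : Function.Surjective (fontaineTheta (integerC F) p))

/-- **`B_dR(F)` as an `F`-algebra** through `F ↪ B_dR⁺ ⊆ B_dR` (to be installed with `letI`).
[cite: FontaineAsterisque223III, Exp. II §1.5.5] -/
abbrev fracAlgebra : Algebra F (FracBdR F p) :=
  ((algebraMap (BDeRhamPlus (integerC F) p) (FracBdR F p)).comp (embBdRHom hp hF)).toAlgebra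

/-- Unfolding of the `F`-algebra structure. [folklore] -/
theorem algebraMap_fracAlgebra (f : F) :
    (letI := fracAlgebra hp hF; algebraMap F (FracBdR F p) f) =
      algebraMap (BDeRhamPlus (integerC F) p) (FracBdR F p) (embBdRHom hp hF f) := rfl

/-- **`Γ_F` fixes `F ⊆ B_dR(F)`.** [cite: FontaineAsterisque223III, Exp. II §1.5.5] -/
theorem smul_algebraMap_fracAlgebra (σ : absoluteGaloisGroup F) (f : F) :
    (letI := fracAlgebra hp hF; σ • algebraMap F (FracBdR F p) f) = (letI := fracAlgebra hp hF; algebraMap F (FracBdR F p) f) := by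
  rw [algebraMap_fracAlgebra, smul_algebraMap_fracBdR, galBdRPlus_embBdRHom]

/-- The `Γ_F`-action on `B_dR(F)` is `F`-linear. [cite: FontaineAsterisque223III, Exp. II §1.5.5] -/
theorem smulCommClass_fracBdR :
    letI := fracAlgebra (p := p) hp hF
    SMulCommClass (absoluteGaloisGroup F) F (FracBdR F p) := by
  letI := fracAlgebra (p := p) hp hF
  refine ⟨fun σ f x => ?_⟩
  rw [Algebra.smul_def, Algebra.smul_def, smul_mul', smul_algebraMap_fracAlgebra]

include hF in
/-- `ξ ≠ 0` in `B_dR(F)`. [folklore] -/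
theorem algebraMap_xiBdR_ne_zero : algebraMap (BDeRhamPlus (integerC F) p) (FracBdR F p) xiBdR ≠ 0 := by
  rw [map_ne_zero_iff _ algebraMap_fracBdR_injective]
  haveI := isMaximal_ker_fontaineThetaInvertP hF
  exact PrincipalCompletion.xiHat_ne_zero ker_fontaineThetaInvertP_eq_span algebraMap_xi_ne_zero

variable [IsDomain (BDeRhamPlus (integerC F) p)]

/-! ### Units and powers -/

omit [CharZero F] in
/-- `B_dR⁺ → B_dR` on inverses of units. [folklore] -/
theorem algebraMap_units_inv (d : (BDeRhamPlus (integerC F) p)ˣ) :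
    algebraMap (BDeRhamPlus (integerC F) p) (FracBdR F p) ((d⁻¹ : (BDeRhamPlus (integerC F) p)ˣ) : BDeRhamPlus (integerC F) p) =
      (algebraMap (BDeRhamPlus (integerC F) p) (FracBdR F p) (d : BDeRhamPlus (integerC F) p))⁻¹ :=
  eq_inv_of_mul_eq_one_left (by rw [← map_mul, Units.inv_mul, map_one])

omit [CharZero F] in
/-- `B_dR⁺ → B_dR` on integer powers of units. [folklore] -/
theorem algebraMap_units_zpow (d : (BDeRhamPlus (integerC F) p)ˣ) : ∀ i : ℤ,
    algebraMap (BDeRhamPlus (integerC F) p) (FracBdR F p) ((d ^ i : (BDeRhamPlus (integerC F) p)ˣ) : BDeRhamPlus (integerC F) p) =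
      (algebraMap (BDeRhamPlus (integerC F) p) (FracBdR F p) (d : BDeRhamPlus (integerC F) p)) ^ i
  | (n : ℕ) => by rw [zpow_natCast, zpow_natCast, Units.val_pow_eq_pow_val, map_pow]
  | Int.negSucc n => by
    rw [zpow_negSucc, zpow_negSucc, algebraMap_units_inv, Units.val_pow_eq_pow_val, map_pow]

/-! ### The filtration `Fil^i = ξ^i B_dR⁺` -/

/-- **`Fil^i B_dR(F) = ξ^i · B_dR⁺(F)`** (`i ∈ ℤ`), as an `F`-submodule. [cite: FontaineAsterisque223III, Exp. II §1.5.5]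
[cite: FontaineOuyang2022, §5.2] -/
def fil (i : ℤ) : letI := fracAlgebra (p := p) hp hF; Submodule F (FracBdR F p) :=
  letI := fracAlgebra (p := p) hp hF
  { carrier := {x | ∃ b : BDeRhamPlus (integerC F) p,
      x = algebraMap (BDeRhamPlus (integerC F) p) (FracBdR F p) xiBdR ^ i * algebraMap (BDeRhamPlus (integerC F) p) (FracBdR F p) b}
    add_mem' := by
      rintro x y ⟨b, rfl⟩ ⟨c, rfl⟩
      exact ⟨b + c, by rw [map_add, mul_add]⟩
    zero_mem' := ⟨0, by rw [map_zero, mul_zero]⟩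
    smul_mem' := by
      rintro f x ⟨b, rfl⟩
      refine ⟨embBdRHom hp hF f * b, ?_⟩
      rw [Algebra.smul_def, algebraMap_fracAlgebra, map_mul]; ring }

/-- Membership in `Fil^i`. [folklore] -/
theorem mem_fil_iff {i : ℤ} {x : FracBdR F p} :
    (letI := fracAlgebra (p := p) hp hF; x ∈ fil hp hF i) ↔ ∃ b : BDeRhamPlus (integerC F) p,
      x = algebraMap (BDeRhamPlus (integerC F) p) (FracBdR F p) xiBdR ^ i * algebraMap (BDeRhamPlus (integerC F) p) (FracBdR F p) b :=
  Iff.rfl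

/-- **The filtration is decreasing.** [cite: FontaineAsterisque223III, Exp. II §1.5.5] -/
theorem fil_antitone : letI := fracAlgebra (p := p) hp hF; Antitone (fil hp hF) := by
  letI := fracAlgebra (p := p) hp hF
  intro i j hij x hx
  rw [mem_fil_iff] at hx ⊢
  obtain ⟨b, rfl⟩ := hx
  obtain ⟨k, hk⟩ := Int.le.dest hij
  refine ⟨xiBdR ^ k * b, ?_⟩
  rw [← hk, zpow_add₀ (algebraMap_xiBdR_ne_zero hF), zpow_natCast, map_mul, map_pow]; ring

/-- **The filtration is multiplicative.** [cite: FontaineAsterisque223III, Exp. II §1.5.5] -/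
theorem mul_mem_fil (i j : ℤ) (x y : FracBdR F p)
    (hx : letI := fracAlgebra (p := p) hp hF; x ∈ fil hp hF i) (hy : letI := fracAlgebra (p := p) hp hF; y ∈ fil hp hF j) :
    letI := fracAlgebra (p := p) hp hF; x * y ∈ fil hp hF (i + j) := by
  rw [mem_fil_iff] at hx hy ⊢
  obtain ⟨b, rfl⟩ := hx
  obtain ⟨c, rfl⟩ := hy
  refine ⟨b * c, ?_⟩
  rw [zpow_add₀ (algebraMap_xiBdR_ne_zero hF), map_mul]; ring

/-- `1 ∈ Fil⁰`. [folklore] -/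
theorem one_mem_fil_zero : letI := fracAlgebra (p := p) hp hF; (1 : FracBdR F p) ∈ fil hp hF 0 :=
  (mem_fil_iff hp hF).2 ⟨1, by rw [zpow_zero, map_one, mul_one]⟩

/-- `B_dR⁺ ⊆ Fil⁰`. [folklore] -/
theorem algebraMap_mem_fil_zero (b : BDeRhamPlus (integerC F) p) :
    letI := fracAlgebra (p := p) hp hF; algebraMap (BDeRhamPlus (integerC F) p) (FracBdR F p) b ∈ fil hp hF 0 :=
  (mem_fil_iff hp hF).2 ⟨b, by rw [zpow_zero, one_mul]⟩

/-- **Each `Fil^i` is `Γ_F`-stable** (`σ(ξ) = ξ·unit`). [cite: FontaineAsterisque223III, Exp. II §1.5.5] -/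
theorem smul_mem_fil (σ : absoluteGaloisGroup F) (i : ℤ) (x : FracBdR F p)
    (hx : letI := fracAlgebra (p := p) hp hF; x ∈ fil hp hF i) :
    letI := fracAlgebra (p := p) hp hF; σ • x ∈ fil hp hF i := by
  rw [mem_fil_iff] at hx ⊢
  obtain ⟨b, rfl⟩ := hx
  obtain ⟨d, hd⟩ := exists_unit_galBdRPlus_xiBdR (F := F) (p := p) σ
  refine ⟨(d ^ i : (BDeRhamPlus (integerC F) p)ˣ) * galBdRPlus σ b, ?_⟩
  rw [smul_fracBdR_eq_toRingHom, map_mul, map_zpow₀, ← smul_fracBdR_eq_toRingHom, ← smul_fracBdR_eq_toRingHom,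
    smul_algebraMap_fracBdR, smul_algebraMap_fracBdR, hd, map_mul, mul_zpow, map_mul, algebraMap_units_zpow]
  ring

/-- **The filtration is exhaustive**: `x = b/c`, `c = ξⁿ·unit`, so `x ∈ Fil^{-n}`. [cite: FontaineAsterisque223III, Exp. II §1.5.5] -/
theorem iSup_fil : letI := fracAlgebra (p := p) hp hF; ⨆ i, fil hp hF i = ⊤ := by
  letI := fracAlgebra (p := p) hp hF
  refine eq_top_iff.2 fun x _ => ?_
  obtain ⟨b, c, hc, rfl⟩ := IsFractionRing.div_surjective (A := BDeRhamPlus (integerC F) p) x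
  have hc0 : c ≠ 0 := mem_nonZeroDivisors_iff_ne_zero.1 hc
  obtain ⟨n, w, hw, rfl⟩ := exists_eq_xi_pow_mul_bDeRhamPlus hF hc0
  refine Submodule.mem_iSup_of_mem (-(n : ℤ)) ((mem_fil_iff hp hF).2 ⟨b * ((hw.unit⁻¹ : (BDeRhamPlus (integerC F) p)ˣ) : BDeRhamPlus (integerC F) p), ?_⟩)
  rw [map_mul, map_mul, map_pow, algebraMap_units_inv, IsUnit.unit_spec, zpow_neg, zpow_natCast, div_eq_mul_inv, mul_inv]
  ring

/-- **The filtration is separated**: `⋂ᵢ ξ^i B_dR⁺ = 0` (`B_dR⁺` is `ξ`-adically separated).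
[cite: FontaineAsterisque223III, Exp. II §1.5.5] -/
theorem iInf_fil : letI := fracAlgebra (p := p) hp hF; ⨅ i, fil hp hF i = ⊥ := by
  letI := fracAlgebra (p := p) hp hF
  refine eq_bot_iff.2 fun x hx => ?_
  rw [Submodule.mem_iInf] at hx
  obtain ⟨b₀, hb₀⟩ := (mem_fil_iff hp hF).1 (hx 0)
  rw [zpow_zero, one_mul] at hb₀
  -- `b₀ ∈ ξⁿ B_dR⁺` for all `n`
  have hmem : ∀ n : ℕ, b₀ ∈ Ideal.span {(xiBdR : BDeRhamPlus (integerC F) p)} ^ n := by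
    intro n
    obtain ⟨b, hb⟩ := (mem_fil_iff hp hF).1 (hx n)
    rw [hb₀, zpow_natCast, ← map_pow, ← map_mul] at hb
    rw [Ideal.span_singleton_pow, Ideal.mem_span_singleton']
    exact ⟨b, by rw [algebraMap_fracBdR_injective hb, mul_comm]⟩
  haveI := isAdicComplete_bDeRhamPlus (F := F) (p := p)
  have h0 : b₀ = 0 := by
    refine IsHausdorff.haus (IsAdicComplete.toIsHausdorff (I := (RingHom.ker (fontaineThetaInvertP (integerC F) p)).map
      (algebraMap (Localization.Away (p : Ainf (p := p) F)) (BDeRhamPlus (integerC F) p)))) b₀ fun n => ?_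
    rw [smul_eq_mul, Ideal.mul_top, SModEq.zero, map_ker_eq_span_xiBdR]
    exact hmem n
  rw [Submodule.mem_bot, hb₀, h0, map_zero]

/-! ### Nonzero elements: `x = u^m · w` -/

include hF in
/-- **Every nonzero `x ∈ B_dR(F)` is `u^m · w`** with `m ∈ ℤ` and `w` a unit of `B_dR⁺(F)`, for the
uniformizer `u = [ε] − 1`. [cite: FontaineAsterisque223III, Exp. II §1.5.5] -/
theorem exists_eq_uBdR_zpow_mul {x : FracBdR F p} (hx : x ≠ 0) :
    ∃ (m : ℤ) (w : (BDeRhamPlus (integerC F) p)ˣ),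
      x = algebraMap (BDeRhamPlus (integerC F) p) (FracBdR F p) uBdR ^ m *
        algebraMap (BDeRhamPlus (integerC F) p) (FracBdR F p) (w : BDeRhamPlus (integerC F) p) := by
  obtain ⟨b, c, hc, rfl⟩ := IsFractionRing.div_surjective (A := BDeRhamPlus (integerC F) p) x
  have hc0 : c ≠ 0 := mem_nonZeroDivisors_iff_ne_zero.1 hc
  have hb0 : b ≠ 0 := fun h => hx (by rw [h, map_zero, zero_div])
  obtain ⟨i, w₁, hw₁, rfl⟩ := exists_eq_xi_pow_mul_bDeRhamPlus hF hb0
  obtain ⟨j, w₂, hw₂, rfl⟩ := exists_eq_xi_pow_mul_bDeRhamPlus hF hc0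
  obtain ⟨v, hv, huv⟩ := exists_uBdR_eq_xiBdR_mul (F := F) (p := p) hF
  -- `ξ = u v⁻¹`
  have hξ : algebraMap (BDeRhamPlus (integerC F) p) (FracBdR F p) xiBdR =
      algebraMap (BDeRhamPlus (integerC F) p) (FracBdR F p) uBdR * algebraMap (BDeRhamPlus (integerC F) p) (FracBdR F p) ((hv.unit⁻¹ : (BDeRhamPlus (integerC F) p)ˣ) : BDeRhamPlus (integerC F) p) := by
    rw [algebraMap_units_inv, IsUnit.unit_spec, huv, map_mul, mul_inv_cancel_right₀]
    exact (map_ne_zero_iff _ algebraMap_fracBdR_injective).2 hv.ne_zero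
  have hu0 : algebraMap (BDeRhamPlus (integerC F) p) (FracBdR F p) uBdR ≠ 0 := by
    rw [map_ne_zero_iff _ algebraMap_fracBdR_injective, huv]
    exact mul_ne_zero ((map_ne_zero_iff _ algebraMap_fracBdR_injective).1 (algebraMap_xiBdR_ne_zero hF)) hv.ne_zero
  refine ⟨(i : ℤ) - j, (hv.unit⁻¹) ^ ((i : ℤ) - j) * (hw₁.unit * hw₂.unit⁻¹), ?_⟩
  have hv'0 : algebraMap (BDeRhamPlus (integerC F) p) (FracBdR F p) ((hv.unit⁻¹ : (BDeRhamPlus (integerC F) p)ˣ) : BDeRhamPlus (integerC F) p) ≠ 0 :=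
    (map_ne_zero_iff _ algebraMap_fracBdR_injective).2 (hv.unit⁻¹).ne_zero
  have hw₂0 : algebraMap (BDeRhamPlus (integerC F) p) (FracBdR F p) w₂ ≠ 0 :=
    (map_ne_zero_iff _ algebraMap_fracBdR_injective).2 hw₂.ne_zero
  have e1 : algebraMap (BDeRhamPlus (integerC F) p) (FracBdR F p)
      ((((hv.unit⁻¹) ^ ((i : ℤ) - j) * (hw₁.unit * hw₂.unit⁻¹) : (BDeRhamPlus (integerC F) p)ˣ)) : BDeRhamPlus (integerC F) p) =
      algebraMap (BDeRhamPlus (integerC F) p) (FracBdR F p) ((hv.unit⁻¹ : (BDeRhamPlus (integerC F) p)ˣ) : BDeRhamPlus (integerC F) p) ^ ((i : ℤ) - j) *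
        (algebraMap (BDeRhamPlus (integerC F) p) (FracBdR F p) w₁ * (algebraMap (BDeRhamPlus (integerC F) p) (FracBdR F p) w₂)⁻¹) := by
    rw [Units.val_mul, Units.val_mul, map_mul, map_mul, algebraMap_units_zpow, IsUnit.unit_spec,
      algebraMap_units_inv hw₂.unit, IsUnit.unit_spec]
  rw [e1, map_mul, map_mul, map_pow, map_pow, hξ, zpow_sub₀ hu0, zpow_sub₀ hv'0, zpow_natCast, zpow_natCast,
    zpow_natCast, zpow_natCast]
  field_simp
  ring

end Algebra

end Literature.NumberTheory.PAdicHodge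

end
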